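import Summits.Ventures.YMGap.RobustBall.BoundaryVariationalPrinciple
import HarnessLib

/-!
# Venture YMGap, track ROBUST-BALL — «C-ENT-μ» (generic part): THE MARGINAL OF A DLR STATE ON A FINITE REGION IS A MIXTURE OF INNER GIBBS LAWS;
# its relative entropy w.r.t. product Haar is at most the mean of theirs (Jensen) and at least the variational bound

HONEST FRAMING. WHAT THIS IS: a venture file (cell `pub-ymgap`, track Y2 ROBUST-BALL / DS, seat ds-3, theorems only, 0 compute), the generic
(every compact metrisable `G`, continuous `ρ`, every `d`, every real `b`) half of «C-ENT-μ»; the `SU(2)` cells are `BoundaryStateEntropy.lean`.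
Objects: a DLR state `μ` of the Wilson specification at coupling `b`, a finite link volume `Λ`, the MARGINAL `μ|_Λ = μ.map (U ↦ U|_Λ)` on the
links of `Λ`, the product Haar law `Haar_Λ`, the inner Gibbs laws `π_Λ^{b,η} = Haar_Λ.tilted(−b S_Λ(· ⊕ η))` with densities
`p_η = exp(−b S_Λ(· ⊕ η))/Z_Λ(b|η)`, Mathlib's `klDiv`.
* ★ `map_restrict_eq_withDensity` — THE MARGINAL IS A MIXTURE OF INNER GIBBS LAWS: `μ|_Λ = Haar_Λ.withDensity(ζ ↦ ∫ p_η(ζ) dμ(η))` (the DLR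
  equation pushed to the inner links; `ymSpecification_preimage_restrict`, `measurable_innerDensity`, `innerDensity_mem_Icc`: `p_η ∈ [e^{−2|b|C}, e^{2|b|C}]`);
* `map_restrict_ac_integrable_llr` — `μ|_Λ ≪ Haar_Λ` with bounded log-likelihood ratio (finite relative entropy);
* ★★ `toReal_klDiv_map_restrict_le` — JENSEN UNDER THE DLR MIXTURE: if `KL(π_Λ^{b,η} ‖ Haar_Λ) ≤ B` for all `η` then `KL(μ|_Λ ‖ Haar_Λ) ≤ B`
  (convexity of `x log x`, Mathlib `ConvexOn.map_integral_le`, Fubini; `toReal_klDiv_inner_law_haar_eq_integral_klFun`);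
* ★ `neg_log_normaliser_sub_le_toReal_klDiv_map_restrict` — THE VARIATIONAL LOWER BOUND: `−log Z_Λ(b|η₀) − b·∫ S_Λ(U|_Λ ⊕ η₀) dμ(U) ≤ KL(μ|_Λ ‖ Haar_Λ)`
  for every auxiliary boundary field `η₀` (`BoundaryVariationalPrinciple.neg_klDiv_sub_energy_le_log_normaliser`);
* `SU(N)` BOOKKEEPING: `card_boundaryPlaquettes_le_card_shallow` (boundary plaquettes are shallow under depth data),
  `suN_abs_action_glue_restrict_sub_le` (`|S_Λ(U|_Λ ⊕ η₀) − S_Λ(U)| ≤ 2N·#∂T(Λ)`), `suN_integral_wilsonBoundaryAction_eq_sum`.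
WHAT THIS IS NOT: no coupling window is used here (pure measure theory of the Wilson specification); lattice; nothing continuum / Clay. Everything
here is proved. [folklore] References: H.-O. Georgii, *Gibbs Measures and Phase Transitions* (2011), Ch. 15 (statement shapes only).
-/

noncomputable section

open MeasureTheory ProbabilityTheory InformationTheory Real Finset Set
open scoped NNReal ENNReal
open Literature.Probability.LatticeModels hiding configShift configShift_apply
open Literature.MathematicalPhysics.QuantumLattice
open Literature.MathematicalPhysics.QuantumFieldTheory (haarProbability)

namespace Summit.Ventures.YMGap.RobustBall

namespace BoundaryFreeEnergy

section Generic

variable {d N : ℕ} {G : Type*} [Group G] [TopologicalSpace G] [IsTopologicalGroup G] [CompactSpace G]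
  [MeasurableSpace G] [BorelSpace G] [SecondCountableTopology G] (ρ : G →* Matrix (Fin N) (Fin N) ℂ)

omit [Group G] [TopologicalSpace G] [IsTopologicalGroup G] [CompactSpace G] [MeasurableSpace G] [BorelSpace G]
  [SecondCountableTopology G] in
/-- Restricting to the inner links undoes the gluing: `(ζ ⊕ η)|_Λ = ζ`. [folklore] -/
theorem restrict_glueWith (Λ : Finset (ZdEdge d)) (ζ : ↥Λ → G) (η : LGConfig d G) :
    (fun e : ↥Λ => glueWith Λ ζ η e) = ζ := by
  funext e; exact glueWith_apply_mem _ _ _ e.2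

/-- The inner density `p_η(ζ) = exp(−b S_Λ(ζ ⊕ η)) / Z_Λ(b|η)` is jointly measurable in `(η, ζ)`. [folklore] -/
theorem measurable_innerDensity (hρ : Continuous ρ) (b : ℝ) (Λ : Finset (ZdEdge d)) :
    Measurable fun p : LGConfig d G × (↥Λ → G) =>
      Real.exp (-b * wilsonBoundaryAction ρ Λ (glueWith Λ p.2 p.1)) /
        ∫ ζ, Real.exp (-b * wilsonBoundaryAction ρ Λ (glueWith Λ ζ p.1)) ∂(Measure.pi fun _ : ↥Λ => haarProbability G) := by
  have hS : Continuous (wilsonBoundaryAction (G := G) ρ Λ) := continuous_wilsonBoundaryAction ρ hρ Λ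
  have h1 : Measurable fun p : LGConfig d G × (↥Λ → G) => Real.exp (-b * wilsonBoundaryAction ρ Λ (glueWith Λ p.2 p.1)) :=
    Real.measurable_exp.comp ((hS.measurable.comp (measurable_glueWith_prod Λ)).const_mul _)
  have h2 : StronglyMeasurable fun p : LGConfig d G × (↥Λ → G) => Real.exp (-b * wilsonBoundaryAction ρ Λ (glueWith Λ p.2 p.1)) :=
    h1.stronglyMeasurable
  have h3 : Measurable fun η : LGConfig d G =>
      ∫ ζ, Real.exp (-b * wilsonBoundaryAction ρ Λ (glueWith Λ ζ η)) ∂(Measure.pi fun _ : ↥Λ => haarProbability G) :=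
    (h2.integral_prod_right' (ν := Measure.pi fun _ : ↥Λ => haarProbability G)).measurable
  exact h1.div (h3.comp measurable_fst)

/-- **Uniform bounds for the inner density**: with `|S_Λ| ≤ C`, `e^{−2|b|C} ≤ p_η(ζ) ≤ e^{2|b|C}`. [folklore] -/
theorem innerDensity_mem_Icc (hρ : Continuous ρ) (b : ℝ) (Λ : Finset (ZdEdge d)) {C : ℝ}
    (hC : ∀ U : LGConfig d G, |wilsonBoundaryAction ρ Λ U| ≤ C) (η : LGConfig d G) (ζ : ↥Λ → G) :
    Real.exp (-b * wilsonBoundaryAction ρ Λ (glueWith Λ ζ η)) /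
        ∫ ζ', Real.exp (-b * wilsonBoundaryAction ρ Λ (glueWith Λ ζ' η)) ∂(Measure.pi fun _ : ↥Λ => haarProbability G) ∈
      Set.Icc (Real.exp (-(2 * |b| * C))) (Real.exp (2 * |b| * C)) := by
  set H : Measure (↥Λ → G) := Measure.pi fun _ : ↥Λ => haarProbability G with hH
  haveI : IsProbabilityMeasure H := by rw [hH]; infer_instance
  have hb : ∀ U : LGConfig d G, |(-b) * wilsonBoundaryAction ρ Λ U| ≤ |b| * C := fun U => by
    rw [abs_mul, abs_neg]; exact mul_le_mul_of_nonneg_left (hC U) (abs_nonneg b)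
  have hlo : ∀ U : LGConfig d G, Real.exp (-(|b| * C)) ≤ Real.exp (-b * wilsonBoundaryAction ρ Λ U) := fun U =>
    Real.exp_le_exp.2 (abs_le.1 (hb U)).1
  have hhi : ∀ U : LGConfig d G, Real.exp (-b * wilsonBoundaryAction ρ Λ U) ≤ Real.exp (|b| * C) := fun U =>
    Real.exp_le_exp.2 (abs_le.1 (hb U)).2
  have hint : Integrable (fun ζ' => Real.exp (-b * wilsonBoundaryAction ρ Λ (glueWith Λ ζ' η))) H :=
    integrable_exp_neg_mul_action_glueWith ρ hρ b Λ η H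
  -- the normaliser is between the same bounds
  have hZlo : Real.exp (-(|b| * C)) ≤ ∫ ζ', Real.exp (-b * wilsonBoundaryAction ρ Λ (glueWith Λ ζ' η)) ∂H := by
    have h := integral_mono (integrable_const (Real.exp (-(|b| * C)))) hint fun ζ' => hlo (glueWith Λ ζ' η)
    simpa using h
  have hZhi : ∫ ζ', Real.exp (-b * wilsonBoundaryAction ρ Λ (glueWith Λ ζ' η)) ∂H ≤ Real.exp (|b| * C) := by
    have h := integral_mono hint (integrable_const (Real.exp (|b| * C))) fun ζ' => hhi (glueWith Λ ζ' η)
    simpa using h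
  have hZpos : 0 < ∫ ζ', Real.exp (-b * wilsonBoundaryAction ρ Λ (glueWith Λ ζ' η)) ∂H := lt_of_lt_of_le (Real.exp_pos _) hZlo
  constructor
  · rw [le_div_iff₀ hZpos]
    calc Real.exp (-(2 * |b| * C)) * ∫ ζ', Real.exp (-b * wilsonBoundaryAction ρ Λ (glueWith Λ ζ' η)) ∂H
        ≤ Real.exp (-(2 * |b| * C)) * Real.exp (|b| * C) := mul_le_mul_of_nonneg_left hZhi (Real.exp_nonneg _)
      _ = Real.exp (-(|b| * C)) := by rw [← Real.exp_add]; ring_nf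
      _ ≤ Real.exp (-b * wilsonBoundaryAction ρ Λ (glueWith Λ ζ η)) := hlo _
  · rw [div_le_iff₀ hZpos]
    calc Real.exp (-b * wilsonBoundaryAction ρ Λ (glueWith Λ ζ η)) ≤ Real.exp (|b| * C) := hhi _
      _ = Real.exp (2 * |b| * C) * Real.exp (-(|b| * C)) := by rw [← Real.exp_add]; ring_nf
      _ ≤ Real.exp (2 * |b| * C) * ∫ ζ', Real.exp (-b * wilsonBoundaryAction ρ Λ (glueWith Λ ζ' η)) ∂H :=
          mul_le_mul_of_nonneg_left hZlo (Real.exp_nonneg _)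

/-- **The DLR kernel of a restricted event**: `γ_Λ({U : U|_Λ ∈ A} | η) = ∫_A p_η dHaar_Λ`. [folklore] -/
theorem ymSpecification_preimage_restrict (hρ : Continuous ρ) (b : ℝ) (Λ : Finset (ZdEdge d)) (η : LGConfig d G)
    {A : Set (↥Λ → G)} (hA : MeasurableSet A) :
    ymSpecification ρ b Λ η ((fun (U : LGConfig d G) (e : ↥Λ) => U e) ⁻¹' A) =
      ∫⁻ ζ in A, ENNReal.ofReal (Real.exp (-b * wilsonBoundaryAction ρ Λ (glueWith Λ ζ η)) /
        ∫ ζ', Real.exp (-b * wilsonBoundaryAction ρ Λ (glueWith Λ ζ' η)) ∂(Measure.pi fun _ : ↥Λ => haarProbability G))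
        ∂(Measure.pi fun _ : ↥Λ => haarProbability G) := by
  have hr : Measurable fun (U : LGConfig d G) (e : ↥Λ) => U e := measurable_pi_lambda _ fun e => measurable_pi_apply _
  have hg : Measurable (glueWith Λ · η) := measurable_glueWith Λ η
  have hw : Continuous fun U : LGConfig d G => Real.exp (-b * wilsonBoundaryAction ρ Λ U) :=
    Real.continuous_exp.comp (continuous_const.mul (continuous_wilsonBoundaryAction ρ hρ Λ))
  simp only [ymSpecification]
  rw [tilted_apply' _ _ (hr hA), integral_map hg.aemeasurable hw.aestronglyMeasurable, setLIntegral_map (hr hA) ?_ hg]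
  · have hpre : (glueWith Λ · η) ⁻¹' ((fun (U : LGConfig d G) (e : ↥Λ) => U e) ⁻¹' A) = A := by
      ext ζ; simp only [Set.mem_preimage, restrict_glueWith]
    rw [hpre]
  · exact ENNReal.measurable_ofReal.comp (hw.measurable.div_const _)

/-- ★ **THE MARGINAL OF A DLR STATE ON A FINITE REGION IS A MIXTURE OF INNER GIBBS LAWS**: for every DLR state `μ` of the Wilson specification
at coupling `b` and every finite `Λ`, the law of the inner links `U|_Λ` under `μ` has the density `ζ ↦ ∫ p_η(ζ) dμ(η)` with respect to the
product Haar law, `p_η = exp(−b S_Λ(· ⊕ η))/Z_Λ(b|η)` (the DLR equation `μ = ∫ γ_Λ(·|η) dμ(η)` pushed to the inner links). [folklore] -/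
theorem map_restrict_eq_withDensity (hρ : Continuous ρ) (b : ℝ) (Λ : Finset (ZdEdge d)) {μ : Measure (LGConfig d G)}
    (hμ : μ ∈ ymGibbsMeasures ρ b) :
    μ.map (fun U (e : ↥Λ) => U e) =
      (Measure.pi fun _ : ↥Λ => haarProbability G).withDensity fun ζ => ENNReal.ofReal
        (∫ η, Real.exp (-b * wilsonBoundaryAction ρ Λ (glueWith Λ ζ η)) /
          ∫ ζ', Real.exp (-b * wilsonBoundaryAction ρ Λ (glueWith Λ ζ' η)) ∂(Measure.pi fun _ : ↥Λ => haarProbability G) ∂μ) := by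
  set H : Measure (↥Λ → G) := Measure.pi fun _ : ↥Λ => haarProbability G with hH
  have hGibbs : IsGibbsMeasure (ymSpecification ρ b) μ := hμ
  haveI := hGibbs.isProbabilityMeasure
  have hr : Measurable fun (U : LGConfig d G) (e : ↥Λ) => U e := measurable_pi_lambda _ fun e => measurable_pi_apply _
  set p : LGConfig d G × (↥Λ → G) → ℝ := fun q => Real.exp (-b * wilsonBoundaryAction ρ Λ (glueWith Λ q.2 q.1)) /
      ∫ ζ, Real.exp (-b * wilsonBoundaryAction ρ Λ (glueWith Λ ζ q.1)) ∂H with hp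
  have hpm : Measurable p := measurable_innerDensity ρ hρ b Λ
  obtain ⟨C, hC⟩ := exists_bound_of_continuous (continuous_wilsonBoundaryAction (G := G) ρ hρ Λ)
  have hpb : ∀ q, p q ∈ Set.Icc (Real.exp (-(2 * |b| * C))) (Real.exp (2 * |b| * C)) := fun q =>
    innerDensity_mem_Icc ρ hρ b Λ hC q.1 q.2
  ext A hA
  rw [Measure.map_apply hr hA, withDensity_apply _ hA, ← hGibbs.2 Λ _ (hr hA)]
  simp_rw [ymSpecification_preimage_restrict ρ hρ b Λ _ hA]
  -- Tonelli: swap `η` and `ζ`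
  have hsw : ∫⁻ η, ∫⁻ ζ in A, ENNReal.ofReal (p (η, ζ)) ∂H ∂μ = ∫⁻ ζ in A, ∫⁻ η, ENNReal.ofReal (p (η, ζ)) ∂μ ∂H :=
    lintegral_lintegral_swap ((ENNReal.measurable_ofReal.comp hpm).aemeasurable)
  rw [show (fun η => ∫⁻ ζ in A, ENNReal.ofReal (Real.exp (-b * wilsonBoundaryAction ρ Λ (glueWith Λ ζ η)) /
      ∫ ζ', Real.exp (-b * wilsonBoundaryAction ρ Λ (glueWith Λ ζ' η)) ∂H) ∂H) = fun η => ∫⁻ ζ in A, ENNReal.ofReal (p (η, ζ)) ∂H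
      from rfl, hsw]
  refine setLIntegral_congr_fun hA fun ζ _ => ?_
  -- `∫⁻ ofReal p dμ = ofReal ∫ p dμ` (bounded, nonnegative)
  rw [← ofReal_integral_eq_lintegral_ofReal]
  · refine Integrable.of_bound (hpm.comp (measurable_id.prodMk measurable_const)).aestronglyMeasurable (Real.exp (2 * |b| * C))
      (ae_of_all _ fun η => ?_)
    rw [Real.norm_eq_abs, abs_of_nonneg ((Real.exp_nonneg _).trans (hpb (η, ζ)).1)]
    exact (hpb (η, ζ)).2
  · exact ae_of_all _ fun η => (Real.exp_nonneg _).trans (hpb (η, ζ)).1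

/-- **The relative entropy of an inner Gibbs law as a `klFun` integral**: `KL(π_Λ^{b,η} ‖ Haar_Λ) = ∫ klFun(p_η) dHaar_Λ`. [folklore] -/
theorem toReal_klDiv_inner_law_haar_eq_integral_klFun (hρ : Continuous ρ) (b : ℝ) (Λ : Finset (ZdEdge d)) (η : LGConfig d G) :
    (klDiv ((Measure.pi fun _ : ↥Λ => haarProbability G).tilted (fun ζ => -b * wilsonBoundaryAction ρ Λ (glueWith Λ ζ η)))
        (Measure.pi fun _ : ↥Λ => haarProbability G)).toReal =
      ∫ ζ, klFun (Real.exp (-b * wilsonBoundaryAction ρ Λ (glueWith Λ ζ η)) /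
        ∫ ζ', Real.exp (-b * wilsonBoundaryAction ρ Λ (glueWith Λ ζ' η)) ∂(Measure.pi fun _ : ↥Λ => haarProbability G))
        ∂(Measure.pi fun _ : ↥Λ => haarProbability G) := by
  set H : Measure (↥Λ → G) := Measure.pi fun _ : ↥Λ => haarProbability G with hH
  set f : (↥Λ → G) → ℝ := fun ζ => -b * wilsonBoundaryAction ρ Λ (glueWith Λ ζ η) with hf
  have hS : Continuous (wilsonBoundaryAction (G := G) ρ Λ) := continuous_wilsonBoundaryAction ρ hρ Λ
  have hfm : Measurable f := (hS.measurable.comp (measurable_glueWith Λ η)).const_mul _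
  rw [toReal_klDiv_eq_integral_klFun (tilted_absolutelyContinuous H f)]
  refine integral_congr_ae ?_
  filter_upwards [rnDeriv_tilted_left_self (μ := H) hfm.aemeasurable] with ζ hζ
  rw [hζ, ENNReal.toReal_ofReal (div_nonneg (Real.exp_nonneg _) (integral_nonneg fun _ => Real.exp_nonneg _))]

/-- **The marginal of a DLR state is absolutely continuous w.r.t. the product Haar law with integrable (indeed bounded) log-likelihood
ratio**, so its relative entropy is finite. [folklore] -/
theorem map_restrict_ac_integrable_llr (hρ : Continuous ρ) (b : ℝ) (Λ : Finset (ZdEdge d)) {μ : Measure (LGConfig d G)}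
    (hμ : μ ∈ ymGibbsMeasures ρ b) :
    μ.map (fun U (e : ↥Λ) => U e) ≪ (Measure.pi fun _ : ↥Λ => haarProbability G) ∧
    Integrable (llr (μ.map (fun U (e : ↥Λ) => U e)) (Measure.pi fun _ : ↥Λ => haarProbability G)) (μ.map (fun U (e : ↥Λ) => U e)) := by
  set H : Measure (↥Λ → G) := Measure.pi fun _ : ↥Λ => haarProbability G with hH
  haveI : IsProbabilityMeasure H := by rw [hH]; infer_instance
  have hGibbs : IsGibbsMeasure (ymSpecification ρ b) μ := hμ
  haveI := hGibbs.isProbabilityMeasure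
  set p : LGConfig d G × (↥Λ → G) → ℝ := fun q => Real.exp (-b * wilsonBoundaryAction ρ Λ (glueWith Λ q.2 q.1)) /
      ∫ ζ, Real.exp (-b * wilsonBoundaryAction ρ Λ (glueWith Λ ζ q.1)) ∂H with hp
  have hpm : Measurable p := measurable_innerDensity ρ hρ b Λ
  obtain ⟨C, hC⟩ := exists_bound_of_continuous (continuous_wilsonBoundaryAction (G := G) ρ hρ Λ)
  set lo := Real.exp (-(2 * |b| * C)) with hlo
  set hi := Real.exp (2 * |b| * C) with hhi
  have hlo0 : 0 < lo := Real.exp_pos _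
  have hpb : ∀ q, p q ∈ Set.Icc lo hi := fun q => innerDensity_mem_Icc ρ hρ b Λ hC q.1 q.2
  set ρbar : (↥Λ → G) → ℝ := fun ζ => ∫ η, p (η, ζ) ∂μ with hρbar
  have hρbar_m : Measurable ρbar := (hpm.stronglyMeasurable.integral_prod_left' (μ := μ)).measurable
  have hpζ_int : ∀ ζ, Integrable (fun η => p (η, ζ)) μ := fun ζ =>
    Integrable.of_bound (hpm.comp (measurable_id.prodMk measurable_const)).aestronglyMeasurable hi
      (ae_of_all _ fun η => by rw [Real.norm_eq_abs, abs_of_nonneg (hlo0.le.trans (hpb (η, ζ)).1)]; exact (hpb (η, ζ)).2)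
  have hρbar_b : ∀ ζ, ρbar ζ ∈ Set.Icc lo hi := fun ζ => by
    constructor
    · have h := integral_mono (integrable_const lo) (hpζ_int ζ) fun η => (hpb (η, ζ)).1
      simpa using h
    · have h := integral_mono (hpζ_int ζ) (integrable_const hi) fun η => (hpb (η, ζ)).2
      simpa using h
  have hmap : μ.map (fun U (e : ↥Λ) => U e) = H.withDensity fun ζ => ENNReal.ofReal (ρbar ζ) := map_restrict_eq_withDensity ρ hρ b Λ hμ
  have hac : μ.map (fun U (e : ↥Λ) => U e) ≪ H := by rw [hmap]; exact withDensity_absolutelyContinuous _ _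
  have hrn : (μ.map (fun U (e : ↥Λ) => U e)).rnDeriv H =ᵐ[H] fun ζ => ENNReal.ofReal (ρbar ζ) := by
    rw [hmap]; exact Measure.rnDeriv_withDensity H (ENNReal.measurable_ofReal.comp hρbar_m)
  refine ⟨hac, ?_⟩
  have hae : llr (μ.map (fun U (e : ↥Λ) => U e)) H =ᵐ[μ.map (fun U (e : ↥Λ) => U e)] fun ζ => Real.log (ρbar ζ) := by
    filter_upwards [hac.ae_le hrn] with ζ hζ
    rw [llr, hζ, ENNReal.toReal_ofReal (hlo0.le.trans (hρbar_b ζ).1)]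
  refine (integrable_congr hae).2 (Integrable.of_bound (Real.measurable_log.comp hρbar_m).aestronglyMeasurable (2 * |b| * C)
    (ae_of_all _ fun ζ => ?_))
  rw [Real.norm_eq_abs, abs_le]
  constructor
  · have h := Real.log_le_log hlo0 (hρbar_b ζ).1
    rw [hlo, Real.log_exp] at h; linarith
  · have h := Real.log_le_log (hlo0.trans_le (hρbar_b ζ).1) (hρbar_b ζ).2
    rw [hhi, Real.log_exp] at h; linarith

/-- ★★ **THE RELATIVE ENTROPY OF THE MARGINAL OF A DLR STATE IS AT MOST THE MEAN RELATIVE ENTROPY OF THE INNER GIBBS LAWS** (convexity of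
`x log x`, Jensen under the DLR mixture): for every DLR state `μ` at coupling `b`, every finite `Λ` and every bound `B` with
`KL(π_Λ^{b,η} ‖ Haar_Λ) ≤ B` for ALL boundary fields `η`: `KL(μ|_Λ ‖ Haar_Λ) ≤ B`, and this divergence is finite. [folklore] -/
theorem toReal_klDiv_map_restrict_le (hρ : Continuous ρ) (b : ℝ) (Λ : Finset (ZdEdge d)) {μ : Measure (LGConfig d G)}
    (hμ : μ ∈ ymGibbsMeasures ρ b) {B : ℝ}
    (hB : ∀ η : LGConfig d G, (klDiv ((Measure.pi fun _ : ↥Λ => haarProbability G).tilted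
      (fun ζ => -b * wilsonBoundaryAction ρ Λ (glueWith Λ ζ η))) (Measure.pi fun _ : ↥Λ => haarProbability G)).toReal ≤ B) :
    klDiv (μ.map (fun U (e : ↥Λ) => U e)) (Measure.pi fun _ : ↥Λ => haarProbability G) ≠ ∞ ∧
    (klDiv (μ.map (fun U (e : ↥Λ) => U e)) (Measure.pi fun _ : ↥Λ => haarProbability G)).toReal ≤ B := by
  set H : Measure (↥Λ → G) := Measure.pi fun _ : ↥Λ => haarProbability G with hH
  haveI : IsProbabilityMeasure H := by rw [hH]; infer_instance
  have hGibbs : IsGibbsMeasure (ymSpecification ρ b) μ := hμ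
  haveI := hGibbs.isProbabilityMeasure
  have hr : Measurable fun (U : LGConfig d G) (e : ↥Λ) => U e := measurable_pi_lambda _ fun e => measurable_pi_apply _
  haveI : IsProbabilityMeasure (μ.map (fun U (e : ↥Λ) => U e)) := Measure.isProbabilityMeasure_map hr.aemeasurable
  set p : LGConfig d G × (↥Λ → G) → ℝ := fun q => Real.exp (-b * wilsonBoundaryAction ρ Λ (glueWith Λ q.2 q.1)) /
      ∫ ζ, Real.exp (-b * wilsonBoundaryAction ρ Λ (glueWith Λ ζ q.1)) ∂H with hp
  have hpm : Measurable p := measurable_innerDensity ρ hρ b Λ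
  obtain ⟨C, hC⟩ := exists_bound_of_continuous (continuous_wilsonBoundaryAction (G := G) ρ hρ Λ)
  set lo := Real.exp (-(2 * |b| * C)) with hlo
  set hi := Real.exp (2 * |b| * C) with hhi
  have hlo0 : 0 < lo := Real.exp_pos _
  have hpb : ∀ q, p q ∈ Set.Icc lo hi := fun q => innerDensity_mem_Icc ρ hρ b Λ hC q.1 q.2
  -- the mixture density
  set ρbar : (↥Λ → G) → ℝ := fun ζ => ∫ η, p (η, ζ) ∂μ with hρbar
  have hρbar_m : Measurable ρbar := (hpm.stronglyMeasurable.integral_prod_left' (μ := μ)).measurable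
  have hpζ_int : ∀ ζ, Integrable (fun η => p (η, ζ)) μ := fun ζ =>
    Integrable.of_bound (hpm.comp (measurable_id.prodMk measurable_const)).aestronglyMeasurable hi
      (ae_of_all _ fun η => by rw [Real.norm_eq_abs, abs_of_nonneg (hlo0.le.trans (hpb (η, ζ)).1)]; exact (hpb (η, ζ)).2)
  have hρbar_b : ∀ ζ, ρbar ζ ∈ Set.Icc lo hi := fun ζ => by
    constructor
    · have h := integral_mono (integrable_const lo) (hpζ_int ζ) fun η => (hpb (η, ζ)).1
      simpa using h
    · have h := integral_mono (hpζ_int ζ) (integrable_const hi) fun η => (hpb (η, ζ)).2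
      simpa using h
  have hmap : μ.map (fun U (e : ↥Λ) => U e) = H.withDensity fun ζ => ENNReal.ofReal (ρbar ζ) := map_restrict_eq_withDensity ρ hρ b Λ hμ
  have hac : μ.map (fun U (e : ↥Λ) => U e) ≪ H := by rw [hmap]; exact withDensity_absolutelyContinuous _ _
  have hrn : (μ.map (fun U (e : ↥Λ) => U e)).rnDeriv H =ᵐ[H] fun ζ => ENNReal.ofReal (ρbar ζ) := by
    rw [hmap]; exact Measure.rnDeriv_withDensity H (ENNReal.measurable_ofReal.comp hρbar_m)
  -- a bound for `klFun` on `[lo, hi]` and on `[0, hi]`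
  obtain ⟨M, hM⟩ := isCompact_Icc.exists_bound_of_continuousOn (continuous_klFun.continuousOn (s := Set.Icc 0 hi))
  have hMp : ∀ x ∈ Set.Icc lo hi, |klFun x| ≤ M := fun x hx => by
    have h := hM x ⟨hlo0.le.trans hx.1, hx.2⟩; rwa [Real.norm_eq_abs] at h
  -- (1) the divergence is finite
  have hllr := (map_restrict_ac_integrable_llr ρ hρ b Λ hμ).2
  refine ⟨klDiv_ne_top hac hllr, ?_⟩
  -- (2) KL(μ_Λ ‖ H) = ∫ klFun(ρbar) dH
  have hKL : (klDiv (μ.map (fun U (e : ↥Λ) => U e)) H).toReal = ∫ ζ, klFun (ρbar ζ) ∂H := by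
    rw [toReal_klDiv_eq_integral_klFun hac]
    refine integral_congr_ae ?_
    filter_upwards [hrn] with ζ hζ
    rw [hζ, ENNReal.toReal_ofReal (hlo0.le.trans (hρbar_b ζ).1)]
  -- (3) Jensen pointwise: klFun(∫ p dμ) ≤ ∫ klFun(p) dμ
  have hJ : ∀ ζ, klFun (ρbar ζ) ≤ ∫ η, klFun (p (η, ζ)) ∂μ := fun ζ => by
    refine ConvexOn.map_integral_le convexOn_klFun continuous_klFun.continuousOn isClosed_Ici
      (ae_of_all _ fun η => hlo0.le.trans (hpb (η, ζ)).1) (hpζ_int ζ) ?_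
    exact Integrable.of_bound ((continuous_klFun.measurable.comp hpm).comp (measurable_id.prodMk measurable_const)).aestronglyMeasurable M
      (ae_of_all _ fun η => by rw [Real.norm_eq_abs]; exact hMp _ (hpb (η, ζ)))
  -- (4) Fubini: ∫_ζ ∫_η klFun(p) = ∫_η ∫_ζ klFun(p) = ∫_η KL(π^η ‖ H)
  have hprod : Integrable (Function.uncurry fun (ζ : ↥Λ → G) (η : LGConfig d G) => klFun (p (η, ζ))) (H.prod μ) := by
    refine Integrable.of_bound ?_ M (ae_of_all _ fun q => by rw [Real.norm_eq_abs]; exact hMp _ (hpb (q.2, q.1)))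
    exact ((continuous_klFun.measurable.comp hpm).comp measurable_swap).aestronglyMeasurable
  have hswap : ∫ ζ, ∫ η, klFun (p (η, ζ)) ∂μ ∂H = ∫ η, ∫ ζ, klFun (p (η, ζ)) ∂H ∂μ := integral_integral_swap hprod
  have hinner : ∀ η, ∫ ζ, klFun (p (η, ζ)) ∂H = (klDiv (H.tilted (fun ζ => -b * wilsonBoundaryAction ρ Λ (glueWith Λ ζ η))) H).toReal :=
    fun η => (toReal_klDiv_inner_law_haar_eq_integral_klFun ρ hρ b Λ η).symm
  -- (5) assemble
  calc (klDiv (μ.map (fun U (e : ↥Λ) => U e)) H).toReal = ∫ ζ, klFun (ρbar ζ) ∂H := hKL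
    _ ≤ ∫ ζ, ∫ η, klFun (p (η, ζ)) ∂μ ∂H := by
        refine integral_mono_of_nonneg (ae_of_all _ fun ζ => klFun_nonneg (hlo0.le.trans (hρbar_b ζ).1)) hprod.integral_prod_left ?_
        exact ae_of_all _ hJ
    _ = ∫ η, (klDiv (H.tilted (fun ζ => -b * wilsonBoundaryAction ρ Λ (glueWith Λ ζ η))) H).toReal ∂μ := by
        rw [hswap]; exact integral_congr_ae (ae_of_all _ hinner)
    _ ≤ ∫ η, B ∂μ := by
        refine integral_mono_of_nonneg (ae_of_all _ fun η => ENNReal.toReal_nonneg) (integrable_const B) (ae_of_all _ hB)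
    _ = B := by simp

/-- ★ **LOWER BOUND FROM THE VARIATIONAL INEQUALITY**: for every DLR state `μ` at coupling `b`, every finite `Λ` and EVERY auxiliary boundary
field `η₀`: `−log Z_Λ(b|η₀) − b·∫ S_Λ(U|_Λ ⊕ η₀) dμ(U) ≤ KL(μ|_Λ ‖ Haar_Λ)` (the finite-volume Gibbs variational inequality of
`BoundaryVariationalPrinciple` applied to the marginal). [folklore] -/
theorem neg_log_normaliser_sub_le_toReal_klDiv_map_restrict (hρ : Continuous ρ) (b : ℝ) (Λ : Finset (ZdEdge d))
    {μ : Measure (LGConfig d G)} (hμ : μ ∈ ymGibbsMeasures ρ b) (η₀ : LGConfig d G) :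
    -Real.log (∫ ζ, Real.exp (-b * wilsonBoundaryAction ρ Λ (glueWith Λ ζ η₀)) ∂(Measure.pi fun _ : ↥Λ => haarProbability G)) -
        b * ∫ U, wilsonBoundaryAction ρ Λ (glueWith Λ (fun e : ↥Λ => U e) η₀) ∂μ ≤
      (klDiv (μ.map (fun U (e : ↥Λ) => U e)) (Measure.pi fun _ : ↥Λ => haarProbability G)).toReal := by
  have hGibbs : IsGibbsMeasure (ymSpecification ρ b) μ := hμ
  haveI := hGibbs.isProbabilityMeasure
  have hr : Measurable fun (U : LGConfig d G) (e : ↥Λ) => U e := measurable_pi_lambda _ fun e => measurable_pi_apply _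
  haveI : IsProbabilityMeasure (μ.map (fun U (e : ↥Λ) => U e)) := Measure.isProbabilityMeasure_map hr.aemeasurable
  obtain ⟨hac, hint⟩ := map_restrict_ac_integrable_llr ρ hρ b Λ hμ
  have h := neg_klDiv_sub_energy_le_log_normaliser ρ hρ b Λ η₀ (μ.map (fun U (e : ↥Λ) => U e)) hac hint
  have hS : Continuous (wilsonBoundaryAction (G := G) ρ Λ) := continuous_wilsonBoundaryAction ρ hρ Λ
  have hint2 : ∫ ζ, wilsonBoundaryAction ρ Λ (glueWith Λ ζ η₀) ∂(μ.map (fun U (e : ↥Λ) => U e)) =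
      ∫ U, wilsonBoundaryAction ρ Λ (glueWith Λ (fun e : ↥Λ => U e) η₀) ∂μ :=
    integral_map hr.aemeasurable ((hS.measurable.comp (measurable_glueWith Λ η₀)).aestronglyMeasurable)
  rw [hint2] at h
  linarith

end Generic

/-! ### Part B — bookkeeping on `SU(N)`: the boundary plaquettes, the energy of the state, the glued-restricted action -/

section SUN

variable {d N : ℕ}

/-- **Boundary plaquettes are shallow**: under depth data `(φ, m)` of `Λ` (`φ > 0 ⇒ ∈ Λ`, `m_p ≤ φ` on the links of `p`), every plaquette
touching `Λ` with a link outside `Λ` has `m_p ≤ 0 < 4K` for `K ≥ 1`. [folklore] -/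
theorem card_boundaryPlaquettes_le_card_shallow (Λ : Finset (ZdEdge d)) (φ : ZdEdge d → ℝ) (hφΛ : ∀ x, 0 < φ x → x ∈ Λ)
    (m : ZdPlaquette d → ℝ) (hm : ∀ p ∈ plaquettesTouching Λ, ∀ x ∈ plaquetteEdges p, m p ≤ φ x) {K : ℕ} (hK : 1 ≤ K) :
    ((plaquettesTouching Λ).filter fun p => ¬plaquetteEdges p ⊆ Λ).card ≤ ((plaquettesTouching Λ).filter fun p => m p < 4 * K).card := by
  refine Finset.card_le_card (Finset.monotone_filter_right _ fun p hp hnot => ?_)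
  obtain ⟨x, hx, hxΛ⟩ := Finset.not_subset.1 hnot
  have hφx : φ x ≤ 0 := not_lt.1 fun h => hxΛ (hφΛ x h)
  have h1 : m p ≤ 0 := (hm p hp x hx).trans hφx
  have hK' : (1 : ℝ) ≤ K := by exact_mod_cast hK
  linarith

/-- **Gluing the restriction back with another outer field changes the action by at most `2N` per boundary plaquette**:
`|S_Λ(U|_Λ ⊕ η₀) − S_Λ(U)| ≤ 2N · #{p ∈ T(Λ) : p ⊄ Λ}` (interior plaquettes read only links of `Λ`, where the two fields agree). [folklore] -/
theorem suN_abs_action_glue_restrict_sub_le (Λ : Finset (ZdEdge d)) (U η₀ : LGConfig d (SUN N)) :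
    |wilsonBoundaryAction (fundamentalRep (Fin N)) Λ (glueWith Λ (fun e : ↥Λ => U e) η₀) -
        wilsonBoundaryAction (fundamentalRep (Fin N)) Λ U| ≤
      2 * N * ((plaquettesTouching Λ).filter fun p => ¬plaquetteEdges p ⊆ Λ).card := by
  classical
  set V := glueWith Λ (fun e : ↥Λ => U e) η₀ with hV
  have hVU : ∀ e ∈ Λ, V e = U e := fun e he => by rw [hV, glueWith_apply_mem _ _ _ he]
  have hdiff : wilsonBoundaryAction (fundamentalRep (Fin N)) Λ V - wilsonBoundaryAction (fundamentalRep (Fin N)) Λ U =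
      ∑ p ∈ (plaquettesTouching Λ).filter (fun p => ¬plaquetteEdges p ⊆ Λ),
        (plaquetteObs (fundamentalRep (Fin N)) p.1 p.2.1.1 p.2.1.2 U - plaquetteObs (fundamentalRep (Fin N)) p.1 p.2.1.1 p.2.1.2 V) := by
    unfold wilsonBoundaryAction
    rw [← Finset.sum_sub_distrib, ← Finset.sum_filter_add_sum_filter_not (plaquettesTouching Λ) (fun p => plaquetteEdges p ⊆ Λ)]
    have h0 : ∑ p ∈ (plaquettesTouching Λ).filter (fun p => plaquetteEdges p ⊆ Λ),
        (((N : ℝ) - plaquetteObs (fundamentalRep (Fin N)) p.1 p.2.1.1 p.2.1.2 V) -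
          ((N : ℝ) - plaquetteObs (fundamentalRep (Fin N)) p.1 p.2.1.1 p.2.1.2 U)) = 0 := by
      refine Finset.sum_eq_zero fun p hp => ?_
      have hsub : plaquetteEdges p ⊆ Λ := (Finset.mem_filter.1 hp).2
      have heq : plaquetteObs (fundamentalRep (Fin N)) p.1 p.2.1.1 p.2.1.2 V = plaquetteObs (fundamentalRep (Fin N)) p.1 p.2.1.1 p.2.1.2 U :=
        isCylinder_plaquetteObs (fundamentalRep (Fin N)) p (fun e he => hVU e (hsub (Finset.mem_coe.1 he)))
      rw [heq, sub_self]
    rw [h0, zero_add]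
    exact Finset.sum_congr rfl fun p _ => by ring
  rw [hdiff]
  refine (Finset.abs_sum_le_sum_abs _ _).trans ?_
  refine (Finset.sum_le_card_nsmul _ _ (2 * (N : ℝ)) fun p _ => ?_).trans (by rw [nsmul_eq_mul]; ring_nf; rfl)
  have h1 := abs_plaquetteObs_le_holds (fundamentalRep (Fin N)) fundamentalRep_mem_unitaryGroup p.1 p.2.1.1 p.2.1.2 U
  have h2 := abs_plaquetteObs_le_holds (fundamentalRep (Fin N)) fundamentalRep_mem_unitaryGroup p.1 p.2.1.1 p.2.1.2 V
  calc |plaquetteObs (fundamentalRep (Fin N)) p.1 p.2.1.1 p.2.1.2 U - plaquetteObs (fundamentalRep (Fin N)) p.1 p.2.1.1 p.2.1.2 V|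
      ≤ |plaquetteObs (fundamentalRep (Fin N)) p.1 p.2.1.1 p.2.1.2 U| + |plaquetteObs (fundamentalRep (Fin N)) p.1 p.2.1.1 p.2.1.2 V| :=
        abs_sub _ _
    _ ≤ N + N := add_le_add h1 h2
    _ = 2 * N := by ring

/-- **The mean energy of a state is the sum of its plaquette means**: `∫ S_Λ dμ = Σ_{p ∈ T(Λ)} (N − ∫ Re tr U_p dμ)` for every probability
measure `μ`. [folklore] -/
theorem suN_integral_wilsonBoundaryAction_eq_sum (Λ : Finset (ZdEdge d)) (μ : Measure (LGConfig d (SUN N))) [IsProbabilityMeasure μ] :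
    ∫ U, wilsonBoundaryAction (fundamentalRep (Fin N)) Λ U ∂μ =
      ∑ p ∈ plaquettesTouching Λ, ((N : ℝ) - ∫ U, plaquetteObs (fundamentalRep (Fin N)) p.1 p.2.1.1 p.2.1.2 U ∂μ) := by
  have hρc : Continuous (fundamentalRep (Fin N)) := continuous_fundamentalRep (Fin N)
  have hWi : ∀ p : ZdPlaquette d, Integrable (fun U : LGConfig d (SUN N) =>
      plaquetteObs (fundamentalRep (Fin N)) p.1 p.2.1.1 p.2.1.2 U) μ :=
    fun p => integrable_of_bound (continuous_plaquetteObs (fundamentalRep (Fin N)) hρc _ _ _).measurable.aestronglyMeasurable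
      (C := N) fun U =>
        abs_plaquetteObs_le_holds (fundamentalRep (Fin N)) fundamentalRep_mem_unitaryGroup p.1 p.2.1.1 p.2.1.2 U
  have hI : ∀ p ∈ plaquettesTouching Λ, Integrable (fun U : LGConfig d (SUN N) =>
      (N : ℝ) - plaquetteObs (fundamentalRep (Fin N)) p.1 p.2.1.1 p.2.1.2 U) μ :=
    fun p _ => (integrable_const _).sub (hWi p)
  unfold wilsonBoundaryAction
  rw [integral_finsetSum _ hI]
  refine Finset.sum_congr rfl fun p _ => ?_
  rw [integral_sub (integrable_const _) (hWi p), integral_const, smul_eq_mul, Measure.real, measure_univ, ENNReal.toReal_one,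
    one_mul]

end SUN

end BoundaryFreeEnergy

end Summit.Ventures.YMGap.RobustBall

end
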